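import Literature.AnabelianGeometry.EtaleTheta.FrobenioidThetaDivisorSupportQAdjacencyCount
import Literature.AnabelianGeometry.EtaleTheta.Discharge.Sec5Prop53ThetaOrbit

/-!
# [EtTh] §5, Proposition 5.3 over PERFECT `Φ(A_⊚)`: an automorphism of `Φ(A_⊚)` preserving the principal elements preserves the prime log-divisors; transport along it (repair `Q`, part 5)

Mochizuki, *The étale theta function …*, Publ. RIMS **45** (2009)
[cite: MochizukiEtTh2009, Prop 5.3 p.325–327 (PDF pp.99–101); Rmk 3.8.2; §1 p.240 (PDF p.14)].
Seat abc-iut-L6-d1 (gen 4); proof-only, over the perfect-`Φ` repair `DivisorSupportDataQ` (p441752) and its toolkit;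
the transport half is a port of abc-iut-L2-d4's `Discharge/Sec5Prop53LabelsR.lean` (p424618, over the `ℤ`-reading, vacuous
at perfect `Φ(A_⊚)` by p436191), whose generic lemmas (`DivisorSupportData.gpHom_ext`, `gpMap_gpMap_symm`,
`map_mem_carrier_congr`, `eq_of_forall_natCast_le_mul_iff`) are consumed BY NAME.

THE `ℚ_{>0}`-INDETERMINACY AND ITS ELIMINATION.  For the `ℤ`-reading a monoid automorphism `ψ` of `Φ(A_⊚)` maps
`gen 𝔭 ↦ gen ψ𝔭` automatically (`map_gen'`: a `ℤ_{≥0}`-line has one generator).  For the printed PERFECT `Φ(A_⊚)`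
this is false in general (the squaring map is an automorphism of a perfect monoid): `ψ` maps the `ℚ_{≥0}`-line of
`𝔭` onto that of `ψ𝔭` by a SCALING `r_𝔭 ∈ ℚ_{>0}` (`ord_map_of_mem_submonoid`) — print, proof of (vi) p.327
(PDF p.101): "at least up to `ℚ_{>0}`-multiples … to eliminate the indeterminacy with respect to `ℚ_{>0}`-multiples,
it suffices to consider the zero divisor … of a generator of `O^▹(A)/O^×(A) ≅ ℤ_{≥0}`".  Here the indeterminacy is
eliminated from abc-iut-L2-d4's binder F1-`ψ` ("`ψ^gp` preserves the image of the birational function monoid", in its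
`iff` form `hP`) and the integral intersection-theory binder `PrincipalIffIntegralDegreeZero` (§1 p.240): every prime
log-divisor occurs with coefficient `±1` in a PRINCIPAL finite combination of prime log-divisors (the configuration
`𝔠₁ + 𝔠₂ − 2𝔞 − n` of the proof of (iv), p.326), whose `ψ^gp`-image is principal, hence INTEGRAL, so `r_𝔭 ∈ ℤ_{>0}`;
the same for `ψ⁻¹` gives `r_𝔭 = 1` (`map_gen_of_principal`).  Consequently the orders, supports, cuspidality,
coprimality, linear equivalence and cuspidal minimality are transported along `ψ^gp` exactly as in the `ℤ`-reading
(`ordOf_map`, `ordGp_gpMap`, `supp_gpMap`, …, `isCuspidallyMinimal_gpMap_iff`), and `ψ` COMMUTES with the pinned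
natural isomorphisms between primary components (`map_ncspIso`, `map_cspIso` — Prop. 5.3 (ii)/(iii) for such `ψ`).
HONEST FRAMING: implications between predicates on OUR typed data under explicit binders (asserted nowhere); typed ≠
proved for the genuine curve; no side taken on anything downstream; nothing here lies inside the [IUTchIII] Cor. 3.12
cone. -/

namespace Literature.AnabelianGeometry.EtaleTheta

open CategoryTheory
open Literature.AlgebraicGeometry.Frobenioids

universe w v v' u u'

namespace FrobenioidThetaDivisors

open scoped Classical

variable {C : Type u} [Category.{v} C] {D : Type u'} [Category.{v'} D] {𝔉 : ThetaFrobenioid.{w} C D}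
variable {𝔓 : DivisorPrimeData 𝔉}

namespace DivisorSupportDataQ

variable (ψ : 𝔉.PhiAcirc ≃* 𝔉.PhiAcirc)

/-! ### F1-`ψ` for the inverse -/

/-- If `ψ^gp` preserves the principal elements (`iff` form), so does `(ψ⁻¹)^gp`.
[cite: MochizukiEtTh2009, Prop 5.3 proof p.326 (PDF p.100)] -/
theorem principal_gpMap_symm_iff (𝔖 : DivisorSupportDataQ 𝔓)
    (hP : ∀ x, ThetaFrobenioid.gpMap ψ.toMonoidHom x ∈ 𝔖.principal ↔ x ∈ 𝔖.principal)
    (y : Algebra.GrothendieckGroup 𝔉.PhiAcirc) :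
    ThetaFrobenioid.gpMap ψ.symm.toMonoidHom y ∈ 𝔖.principal ↔ y ∈ 𝔖.principal := by
  rw [← hP, DivisorSupportData.gpMap_gpMap_symm]

/-! ### The scaling factor of `ψ` on the line of a prime -/

/-- `ψ (gen 𝔭)` is a primary element of `ψ𝔭`: positive order at `ψ𝔭`, order `0` elsewhere.
[cite: MochizukiEtTh2009, Prop 5.3 p.325 (PDF p.99)] -/
theorem ord_map_gen (𝔖 : DivisorSupportDataQ 𝔓) (𝔭 : Primes 𝔉.PhiAcirc) :
    0 < 𝔖.ord (Primes.congr ψ 𝔭) (Algebra.GrothendieckGroup.of (ψ (𝔖.gen 𝔭))) ∧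
      ∀ 𝔮, 𝔮 ≠ Primes.congr ψ 𝔭 → 𝔖.ord 𝔮 (Algebra.GrothendieckGroup.of (ψ (𝔖.gen 𝔭))) = 0 :=
  𝔖.ord_of_mem_carrier (DivisorSupportData.map_mem_carrier_congr ψ (𝔖.gen_mem_carrier 𝔭))

/-- **`ψ` is a SCALING on each `ℚ_{≥0}`-line**: for `x ∈ Φ(A_⊚)_𝔭`, `ord_{ψ𝔭}(ψ x) = r_𝔭 · ord_𝔭(x)` with
`r_𝔭 = ord_{ψ𝔭}(ψ (gen 𝔭))` ("up to `ℚ_{>0}`-multiples", p.327 (PDF p.101); `x^{den} = gen^{num}`).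
[cite: MochizukiEtTh2009, Prop 5.3 proof p.327 (PDF p.101)] -/
theorem ord_map_of_mem_submonoid (𝔖 : DivisorSupportDataQ 𝔓) (𝔭 : Primes 𝔉.PhiAcirc) {x : 𝔉.PhiAcirc}
    (hx : x ∈ 𝔭.submonoid) :
    𝔖.ord (Primes.congr ψ 𝔭) (Algebra.GrothendieckGroup.of (ψ x)) =
      𝔖.ord (Primes.congr ψ 𝔭) (Algebra.GrothendieckGroup.of (ψ (𝔖.gen 𝔭))) *
        𝔖.ord 𝔭 (Algebra.GrothendieckGroup.of x) := by
  set r : ℚ := 𝔖.ord 𝔭 (Algebra.GrothendieckGroup.of x) with hr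
  set s : ℚ := 𝔖.ord (Primes.congr ψ 𝔭) (Algebra.GrothendieckGroup.of (ψ (𝔖.gen 𝔭))) with hs
  have hr0 : 0 ≤ r := 𝔖.ord_of_nonneg 𝔭 _
  obtain ⟨num, hnum⟩ : ∃ num : ℕ, (num : ℤ) = r.num := Int.eq_ofNat_of_zero_le (Rat.num_nonneg.mpr hr0) |>.imp
    fun _ h => h.symm
  have hx𝔮 : ∀ 𝔮', 𝔮' ≠ 𝔭 → 𝔖.ord 𝔮' (Algebra.GrothendieckGroup.of x) = 0 := (𝔖.mem_submonoid_iff_ord 𝔭 _).mp hx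
  have h3 : (r.den : ℚ) * r = (num : ℚ) := by
    have := Rat.mul_den_eq_num r; rw [mul_comm] at this; rw [this]; exact_mod_cast hnum.symm
  -- `x ^ den = gen 𝔭 ^ num`
  have hpow : x ^ r.den = 𝔖.gen 𝔭 ^ num := by
    refine 𝔖.eq_of_ord_of_eq fun 𝔮' => ?_
    rw [map_pow, map_pow, ord_pow, ord_pow, ord_gen]
    rcases eq_or_ne 𝔮' 𝔭 with rfl | h
    · rw [if_pos rfl, mul_one, ← hr, h3]
    · rw [if_neg h, hx𝔮 𝔮' h, mul_zero, mul_zero]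
  -- apply `ψ` and take the order at `ψ𝔭`
  have h2 := congrArg (fun c : 𝔉.PhiAcirc => 𝔖.ord (Primes.congr ψ 𝔭) (Algebra.GrothendieckGroup.of (ψ c))) hpow
  simp only [map_pow, ord_pow] at h2
  -- `den * ord (ψ x) = num * s = den * (s * r)`
  have hden : (0 : ℚ) < r.den := Nat.cast_pos.mpr r.den_pos
  rw [← hs, ← h3] at h2
  have : (r.den : ℚ) * 𝔖.ord (Primes.congr ψ 𝔭) (Algebra.GrothendieckGroup.of (ψ x)) = (r.den : ℚ) * (s * r) := by
    rw [h2]; ring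
  exact mul_left_cancel₀ hden.ne' this

/-! ### The principal configurations of the proof of (iv) -/

/-- **The configuration `𝔠₁ + 𝔠₂ − 2𝔞 − n` of the proof of (iv) is principal** under the integral binder: for a
component `𝔪`, cusps `𝔠₁ ↦ 𝔪⁻`, `𝔠₂ ↦ 𝔪⁺`, `𝔞 ↦ 𝔪`, the element `gen 𝔠₁ + gen 𝔠₂ − 2·gen 𝔞 − gen 𝔪` of `Φ(A_⊚)^gp` is
integral and has degree `0` on every component.  [cite: MochizukiEtTh2009, Prop 5.3 proof p.326 (PDF p.100); §1 p.240 (PDF p.14)] -/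
theorem config_mem_principal (𝔖 : DivisorSupportDataQ 𝔓) (hI : 𝔖.PrincipalIffIntegralDegreeZero)
    (𝔪 : {p : Primes 𝔉.PhiAcirc // ¬ 𝔓.IsCuspidal p}) (𝔠₁ 𝔠₂ 𝔞 : {p : Primes 𝔉.PhiAcirc // 𝔓.IsCuspidal p})
    (h𝔠₁ : 𝔓.cspToNcsp 𝔠₁ = ncspShift 𝔓 (-1) 𝔪) (h𝔠₂ : 𝔓.cspToNcsp 𝔠₂ = ncspShift 𝔓 1 𝔪)
    (h𝔞 : 𝔓.cspToNcsp 𝔞 = 𝔪) :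
    Algebra.GrothendieckGroup.of (𝔖.gen 𝔠₁.1) * Algebra.GrothendieckGroup.of (𝔖.gen 𝔠₂.1) *
        (Algebra.GrothendieckGroup.of (𝔖.gen 𝔞.1) ^ 2)⁻¹ * (Algebra.GrothendieckGroup.of (𝔖.gen 𝔪.1))⁻¹ ∈
      𝔖.principal := by
  set G₁ := Algebra.GrothendieckGroup.of (𝔖.gen 𝔠₁.1) with hG₁
  set G₂ := Algebra.GrothendieckGroup.of (𝔖.gen 𝔠₂.1) with hG₂
  set G := Algebra.GrothendieckGroup.of (𝔖.gen 𝔞.1) with hG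
  set N := Algebra.GrothendieckGroup.of (𝔖.gen 𝔪.1) with hN
  have hfinG₁ : (𝔖.supp G₁).Finite := 𝔖.supp_gen_finite _
  have hfinG₂ : (𝔖.supp G₂).Finite := 𝔖.supp_gen_finite _
  have hfinG2 : (𝔖.supp (G ^ 2)).Finite := (𝔖.supp_gen_finite _).subset (𝔖.supp_pow_subset _ _)
  have hfinN : (𝔖.supp N).Finite := 𝔖.supp_gen_finite _
  have hfin12 : (𝔖.supp (G₁ * G₂)).Finite := (hfinG₁.union hfinG₂).subset (𝔖.supp_mul_subset _ _)
  have hfin12A : (𝔖.supp (G₁ * G₂ * (G ^ 2)⁻¹)).Finite :=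
    (hfin12.union (by rwa [supp_inv] : (𝔖.supp (G ^ 2)⁻¹).Finite)).subset (𝔖.supp_mul_subset _ _)
  rw [← isPrincipal_iff_mem]
  refine (hI _).mpr ⟨?_, fun 𝔫 => ?_⟩
  · exact 𝔖.integral_mul (𝔖.integral_mul (𝔖.integral_mul (𝔖.integral_of_gen _) (𝔖.integral_of_gen _))
      (𝔖.integral_inv (𝔖.integral_pow (𝔖.integral_of_gen _) 2))) (𝔖.integral_inv (𝔖.integral_of_gen _))
  · rw [𝔖.degOn_mul 𝔫 hfin12A (by rwa [supp_inv]), degOn_inv, 𝔖.degOn_mul 𝔫 hfin12 (by rwa [supp_inv]),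
      degOn_inv, 𝔖.degOn_mul 𝔫 hfinG₁ hfinG₂, 𝔖.degOn_pow 𝔫 (𝔖.supp_gen_finite _), 𝔖.degOn_gen_cusp 𝔫 𝔠₁,
      𝔖.degOn_gen_cusp 𝔫 𝔠₂, 𝔖.degOn_gen_cusp 𝔫 𝔞, h𝔠₁, h𝔠₂, h𝔞, 𝔖.degOn_gen_ncsp 𝔫 𝔪]
    push_cast
    ring

/-- Every cusp `𝔠` is the left cusp `𝔠₁` of a configuration: centre `𝔪 = (cspToNcsp 𝔠)⁺`.
[cite: MochizukiEtTh2009, Prop 5.3 proof p.326 (PDF p.100)] -/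
theorem exists_config_of_cusp (𝔠 : {p : Primes 𝔉.PhiAcirc // 𝔓.IsCuspidal p}) :
    ∃ (𝔪 : {p : Primes 𝔉.PhiAcirc // ¬ 𝔓.IsCuspidal p}) (𝔠₂ 𝔞 : {p : Primes 𝔉.PhiAcirc // 𝔓.IsCuspidal p}),
      𝔓.cspToNcsp 𝔠 = ncspShift 𝔓 (-1) 𝔪 ∧ 𝔓.cspToNcsp 𝔠₂ = ncspShift 𝔓 1 𝔪 ∧ 𝔓.cspToNcsp 𝔞 = 𝔪 := by
  obtain ⟨𝔠₂, h𝔠₂⟩ := 𝔓.cspToNcsp_surjective (ncspShift 𝔓 1 (ncspShift 𝔓 1 (𝔓.cspToNcsp 𝔠)))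
  obtain ⟨𝔞, h𝔞⟩ := 𝔓.cspToNcsp_surjective (ncspShift 𝔓 1 (𝔓.cspToNcsp 𝔠))
  refine ⟨ncspShift 𝔓 1 (𝔓.cspToNcsp 𝔠), 𝔠₂, 𝔞, ?_, h𝔠₂, h𝔞⟩
  rw [ncspShift_ncspShift, add_neg_cancel, ncspShift_zero]

/-! ### The scaling factors are positive integers, hence `1` -/

/-- **Under F1-`ψ` and the integral binder, the scaling factor of `ψ` at every prime is a positive INTEGER**: the
`ψ^gp`-image of a principal configuration in which `gen 𝔭` has coefficient `±1` is principal, hence integral.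
[cite: MochizukiEtTh2009, Prop 5.3 proof p.326–327 (PDF pp.100–101); §1 p.240 (PDF p.14)] -/
theorem exists_nat_ord_map_gen (𝔖 : DivisorSupportDataQ 𝔓) (hI : 𝔖.PrincipalIffIntegralDegreeZero)
    (hP : ∀ x, ThetaFrobenioid.gpMap ψ.toMonoidHom x ∈ 𝔖.principal ↔ x ∈ 𝔖.principal) (𝔭 : Primes 𝔉.PhiAcirc) :
    ∃ n : ℕ, 0 < n ∧ 𝔖.ord (Primes.congr ψ 𝔭) (Algebra.GrothendieckGroup.of (ψ (𝔖.gen 𝔭))) = n := by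
  -- the orders of `ψ^gp` of a prime log-divisor
  have hordψ : ∀ (𝔮 𝔯 : Primes 𝔉.PhiAcirc), 𝔯 ≠ 𝔮 →
      𝔖.ord (Primes.congr ψ 𝔮) (ThetaFrobenioid.gpMap ψ.toMonoidHom (Algebra.GrothendieckGroup.of (𝔖.gen 𝔯))) = 0 := by
    intro 𝔮 𝔯 h
    rw [ThetaFrobenioid.gpMap_of, MulEquiv.coe_toMonoidHom]
    exact (𝔖.ord_map_gen ψ 𝔯).2 _ fun h' => h ((Primes.congr ψ).injective h').symm
  have hordψ_self : ∀ 𝔮 : Primes 𝔉.PhiAcirc,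
      𝔖.ord (Primes.congr ψ 𝔮) (ThetaFrobenioid.gpMap ψ.toMonoidHom (Algebra.GrothendieckGroup.of (𝔖.gen 𝔮))) =
        𝔖.ord (Primes.congr ψ 𝔮) (Algebra.GrothendieckGroup.of (ψ (𝔖.gen 𝔮))) := by
    intro 𝔮; rw [ThetaFrobenioid.gpMap_of, MulEquiv.coe_toMonoidHom]
  -- integrality of the image of a configuration
  have hint : ∀ (𝔪 : {p : Primes 𝔉.PhiAcirc // ¬ 𝔓.IsCuspidal p}) (𝔠₁ 𝔠₂ 𝔞 : {p : Primes 𝔉.PhiAcirc // 𝔓.IsCuspidal p}),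
      𝔓.cspToNcsp 𝔠₁ = ncspShift 𝔓 (-1) 𝔪 → 𝔓.cspToNcsp 𝔠₂ = ncspShift 𝔓 1 𝔪 → 𝔓.cspToNcsp 𝔞 = 𝔪 →
      𝔖.Integral (ThetaFrobenioid.gpMap ψ.toMonoidHom
        (Algebra.GrothendieckGroup.of (𝔖.gen 𝔠₁.1) * Algebra.GrothendieckGroup.of (𝔖.gen 𝔠₂.1) *
          (Algebra.GrothendieckGroup.of (𝔖.gen 𝔞.1) ^ 2)⁻¹ * (Algebra.GrothendieckGroup.of (𝔖.gen 𝔪.1))⁻¹)) := by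
    intro 𝔪 𝔠₁ 𝔠₂ 𝔞 h₁ h₂ h₃
    exact ((hI _).mp ((𝔖.isPrincipal_iff_mem _).mpr
      ((hP _).mpr (𝔖.config_mem_principal hI 𝔪 𝔠₁ 𝔠₂ 𝔞 h₁ h₂ h₃)))).1
  have hpos := (𝔖.ord_map_gen ψ 𝔭).1
  -- an integer order, positive: a natural number
  suffices hz : ∃ z : ℤ, 𝔖.ord (Primes.congr ψ 𝔭) (Algebra.GrothendieckGroup.of (ψ (𝔖.gen 𝔭))) = z by
    obtain ⟨z, hz⟩ := hz
    have hz0 : (0 : ℤ) < z := by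
      have : (0 : ℚ) < (z : ℚ) := by rw [← hz]; exact hpos
      exact_mod_cast this
    refine ⟨z.toNat, by omega, ?_⟩
    rw [hz]; exact_mod_cast (Int.toNat_of_nonneg hz0.le).symm
  by_cases h𝔭 : 𝔓.IsCuspidal 𝔭
  · -- a cusp is the left cusp of a configuration, coefficient `+1`
    obtain ⟨𝔪, 𝔠₂, 𝔞, h₁, h₂, h₃⟩ := exists_config_of_cusp (𝔓 := 𝔓) ⟨𝔭, h𝔭⟩
    obtain ⟨z, hz⟩ := hint 𝔪 ⟨𝔭, h𝔭⟩ 𝔠₂ 𝔞 h₁ h₂ h₃ (Primes.congr ψ 𝔭)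
    have hne₂ : 𝔠₂.1 ≠ 𝔭 := by
      intro e
      have : 𝔠₂ = ⟨𝔭, h𝔭⟩ := Subtype.ext e
      rw [this, h₁] at h₂
      exact ncspShift_ne_ncspShift (by norm_num) 𝔪 h₂
    have hne𝔞 : 𝔞.1 ≠ 𝔭 := by
      intro e
      have : 𝔞 = ⟨𝔭, h𝔭⟩ := Subtype.ext e
      rw [this, h₁] at h₃
      exact ncspShift_ne_self (by norm_num) 𝔪 h₃
    have hne𝔪 : 𝔪.1 ≠ 𝔭 := fun e => 𝔪.2 (e ▸ h𝔭)
    rw [map_mul, map_mul, map_mul, map_inv, map_inv, map_pow, ord_mul, ord_mul, ord_mul, ord_inv, ord_inv,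
      ord_pow, hordψ_self, hordψ 𝔭 _ hne₂, hordψ 𝔭 _ hne𝔞, hordψ 𝔭 _ hne𝔪] at hz
    exact ⟨z, by linarith⟩
  · -- a component is the centre of a configuration, coefficient `−1`
    obtain ⟨𝔠₁, h₁⟩ := 𝔓.cspToNcsp_surjective (ncspShift 𝔓 (-1) ⟨𝔭, h𝔭⟩)
    obtain ⟨𝔠₂, h₂⟩ := 𝔓.cspToNcsp_surjective (ncspShift 𝔓 1 ⟨𝔭, h𝔭⟩)
    obtain ⟨𝔞, h₃⟩ := 𝔓.cspToNcsp_surjective ⟨𝔭, h𝔭⟩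
    obtain ⟨z, hz⟩ := hint ⟨𝔭, h𝔭⟩ 𝔠₁ 𝔠₂ 𝔞 h₁ h₂ h₃ (Primes.congr ψ 𝔭)
    have hne₁ : 𝔠₁.1 ≠ 𝔭 := fun e => h𝔭 (e ▸ 𝔠₁.2)
    have hne₂ : 𝔠₂.1 ≠ 𝔭 := fun e => h𝔭 (e ▸ 𝔠₂.2)
    have hne𝔞 : 𝔞.1 ≠ 𝔭 := fun e => h𝔭 (e ▸ 𝔞.2)
    rw [map_mul, map_mul, map_mul, map_inv, map_inv, map_pow, ord_mul, ord_mul, ord_mul, ord_inv, ord_inv,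
      ord_pow, hordψ 𝔭 _ hne₁, hordψ 𝔭 _ hne₂, hordψ 𝔭 _ hne𝔞, hordψ_self] at hz
    exact ⟨-z, by push_cast; linarith⟩

/-- **An automorphism of `Φ(A_⊚)` preserving the principal elements preserves the prime log-divisors**:
`ψ (gen 𝔭) = gen (ψ𝔭)` — the `ℚ_{>0}`-indeterminacy of p.327 eliminated from F1-`ψ` and the integral intersection
theory (scaling factors of `ψ` and `ψ⁻¹` are positive integers with product `1`).
[cite: MochizukiEtTh2009, Prop 5.3 proof p.327 (PDF p.101); Rmk 3.8.2; §1 p.240 (PDF p.14)] -/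
theorem map_gen_of_principal (𝔖 : DivisorSupportDataQ 𝔓) (hI : 𝔖.PrincipalIffIntegralDegreeZero)
    (hP : ∀ x, ThetaFrobenioid.gpMap ψ.toMonoidHom x ∈ 𝔖.principal ↔ x ∈ 𝔖.principal) (𝔭 : Primes 𝔉.PhiAcirc) :
    ψ (𝔖.gen 𝔭) = 𝔖.gen (Primes.congr ψ 𝔭) := by
  -- scaling factors of `ψ` at `𝔭` and of `ψ⁻¹` at `ψ𝔭`
  obtain ⟨s, hs, hsv⟩ := 𝔖.exists_nat_ord_map_gen ψ hI hP 𝔭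
  obtain ⟨s', hs', hs'v⟩ :=
    𝔖.exists_nat_ord_map_gen ψ.symm hI (𝔖.principal_gpMap_symm_iff ψ hP) (Primes.congr ψ 𝔭)
  rw [Primes.congr_symm_apply_congr] at hs'v
  -- `y := ψ⁻¹ (gen ψ𝔭) ∈ Φ_𝔭`, and `ψ y = gen ψ𝔭`
  have hy : ψ.symm (𝔖.gen (Primes.congr ψ 𝔭)) ∈ 𝔭.submonoid := by
    have := DivisorSupportData.map_mem_carrier_congr ψ.symm (𝔖.gen_mem_carrier (Primes.congr ψ 𝔭))
    rw [Primes.congr_symm_apply_congr] at this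
    exact Submonoid.subset_closure this
  have h1 := 𝔖.ord_map_of_mem_submonoid ψ 𝔭 hy
  rw [ψ.apply_symm_apply, ord_gen_self, hsv, hs'v] at h1
  -- `1 = s * s'` with positive naturals
  have hss : s * s' = 1 := by exact_mod_cast h1.symm
  have hs1 : s = 1 := Nat.eq_one_of_mul_eq_one_right hss
  -- conclude by comparing orders
  refine 𝔖.eq_of_ord_of_eq fun 𝔮 => ?_
  rcases eq_or_ne 𝔮 (Primes.congr ψ 𝔭) with rfl | h
  · rw [hsv, hs1, Nat.cast_one, ord_gen_self]
  · rw [(𝔖.ord_map_gen ψ 𝔭).2 𝔮 h, 𝔖.ord_gen_of_ne h]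

/-! ### Transport of orders and supports along `ψ^gp` -/

/-- **`ψ` is compatible with the orders**, support-free: `ord_{ψ𝔭}(ψ a) = ord_𝔭(a)` for every `a ∈ Φ(A_⊚)` — by the
sup-characterisation `le_ord_iff` ([FrdI] Def. 2.4 (i)(c)) and `map_gen_of_principal` (port of L2-d4's `ordOf'_map`).
[cite: MochizukiEtTh2009, Prop 5.3 p.325 (PDF p.99)] -/
theorem ordOf_map (𝔖 : DivisorSupportDataQ 𝔓) (hI : 𝔖.PrincipalIffIntegralDegreeZero)
    (hP : ∀ x, ThetaFrobenioid.gpMap ψ.toMonoidHom x ∈ 𝔖.principal ↔ x ∈ 𝔖.principal)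
    (𝔭 : Primes 𝔉.PhiAcirc) (a : 𝔉.PhiAcirc) :
    ordOf' 𝔖.factor (Primes.congr ψ 𝔭) (ψ a) = ordOf' 𝔖.factor 𝔭 a := by
  change 𝔖.factor (ψ a) (Primes.congr ψ 𝔭) = 𝔖.factor a 𝔭
  apply Multiplicative.toAdd.injective
  refine eq_of_forall_natCast_le_mul_iff (𝔖.factor_nonneg _ _) (𝔖.factor_nonneg _ _) fun n m hm => ?_
  rw [𝔖.le_ord_iff _ _ n m hm, 𝔖.le_ord_iff _ _ n m hm, ← 𝔖.map_gen_of_principal ψ hI hP 𝔭, ← map_pow, ← map_pow]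
  constructor
  · intro hd
    have := map_dvd ψ.symm hd
    rwa [ψ.symm_apply_apply, ψ.symm_apply_apply] at this
  · exact map_dvd ψ

/-- The order on `Φ(A_⊚)^gp` extends the order on `Φ(A_⊚)`. [cite: MochizukiEtTh2009, Prop 5.3 proof p.326 (PDF p.100)] -/
theorem ordGp_of (𝔖 : DivisorSupportDataQ 𝔓) (𝔭 : Primes 𝔉.PhiAcirc) (a : 𝔉.PhiAcirc) :
    𝔖.ordGp 𝔭 (Algebra.GrothendieckGroup.of a) = ordOf' 𝔖.factor 𝔭 a := by
  have h := Algebra.GrothendieckGroup.lift.symm_apply_apply (ordOf' 𝔖.factor 𝔭)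
  rw [Algebra.GrothendieckGroup.lift_symm_apply] at h
  exact DFunLike.congr_fun h a

/-- The orders on `Φ(A_⊚)^gp` are transported: `ord_{ψ𝔭}(ψ^gp x) = ord_𝔭(x)`.
[cite: MochizukiEtTh2009, Prop 5.3 proof p.326 (PDF p.100)] -/
theorem ordGp_gpMap (𝔖 : DivisorSupportDataQ 𝔓) (hI : 𝔖.PrincipalIffIntegralDegreeZero)
    (hP : ∀ x, ThetaFrobenioid.gpMap ψ.toMonoidHom x ∈ 𝔖.principal ↔ x ∈ 𝔖.principal)
    (𝔭 : Primes 𝔉.PhiAcirc) (x : Algebra.GrothendieckGroup 𝔉.PhiAcirc) :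
    𝔖.ordGp (Primes.congr ψ 𝔭) (ThetaFrobenioid.gpMap ψ.toMonoidHom x) = 𝔖.ordGp 𝔭 x := by
  have : (𝔖.ordGp (Primes.congr ψ 𝔭)).comp (ThetaFrobenioid.gpMap ψ.toMonoidHom) = 𝔖.ordGp 𝔭 :=
    DivisorSupportData.gpHom_ext fun a => by
      rw [MonoidHom.comp_apply, ThetaFrobenioid.gpMap_of, ordGp_of, MulEquiv.coe_toMonoidHom, ordGp_of]
      exact 𝔖.ordOf_map ψ hI hP 𝔭 a
  exact DFunLike.congr_fun this x

/-- The (additive) orders are transported: `ord_𝔮(ψ^gp x) = ord_{ψ⁻¹ 𝔮}(x)`.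
[cite: MochizukiEtTh2009, Prop 5.3 proof p.326 (PDF p.100)] -/
theorem ord_gpMap (𝔖 : DivisorSupportDataQ 𝔓) (hI : 𝔖.PrincipalIffIntegralDegreeZero)
    (hP : ∀ x, ThetaFrobenioid.gpMap ψ.toMonoidHom x ∈ 𝔖.principal ↔ x ∈ 𝔖.principal)
    (𝔮 : Primes 𝔉.PhiAcirc) (x : Algebra.GrothendieckGroup 𝔉.PhiAcirc) :
    𝔖.ord 𝔮 (ThetaFrobenioid.gpMap ψ.toMonoidHom x) = 𝔖.ord (Primes.congr ψ.symm 𝔮) x := by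
  have h := 𝔖.ordGp_gpMap ψ hI hP (Primes.congr ψ.symm 𝔮) x
  rw [Primes.congr_apply_congr_symm] at h
  simp only [DivisorSupportDataQ.ord, h]

/-- Supports (possibly infinite) are transported: `supp(ψ^gp x) = ψ(supp x)`.
[cite: MochizukiEtTh2009, Prop 5.3 proof p.326 (PDF p.100)] -/
theorem supp_gpMap (𝔖 : DivisorSupportDataQ 𝔓) (hI : 𝔖.PrincipalIffIntegralDegreeZero)
    (hP : ∀ x, ThetaFrobenioid.gpMap ψ.toMonoidHom x ∈ 𝔖.principal ↔ x ∈ 𝔖.principal)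
    (x : Algebra.GrothendieckGroup 𝔉.PhiAcirc) :
    suppOf' 𝔖.factor (ThetaFrobenioid.gpMap ψ.toMonoidHom x) = Primes.congr ψ '' suppOf' 𝔖.factor x := by
  ext 𝔮
  constructor
  · intro h
    refine ⟨Primes.congr ψ.symm 𝔮, ?_, Primes.congr_apply_congr_symm ψ 𝔮⟩
    change 𝔖.ordGp (Primes.congr ψ.symm 𝔮) x ≠ 1
    rw [← 𝔖.ordGp_gpMap ψ hI hP (Primes.congr ψ.symm 𝔮) x, Primes.congr_apply_congr_symm]
    exact h
  · rintro ⟨𝔭, h𝔭, rfl⟩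
    change 𝔖.ordGp (Primes.congr ψ 𝔭) _ ≠ 1
    rw [𝔖.ordGp_gpMap ψ hI hP]
    exact h𝔭

/-- Cardinalities of supports are preserved. [cite: MochizukiEtTh2009, Prop 5.3 proof p.326 (PDF p.100)] -/
theorem ncard_supp_gpMap (𝔖 : DivisorSupportDataQ 𝔓) (hI : 𝔖.PrincipalIffIntegralDegreeZero)
    (hP : ∀ x, ThetaFrobenioid.gpMap ψ.toMonoidHom x ∈ 𝔖.principal ↔ x ∈ 𝔖.principal)
    (x : Algebra.GrothendieckGroup 𝔉.PhiAcirc) :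
    (suppOf' 𝔖.factor (ThetaFrobenioid.gpMap ψ.toMonoidHom x)).ncard = (suppOf' 𝔖.factor x).ncard := by
  rw [𝔖.supp_gpMap ψ hI hP, Set.ncard_image_of_injective _ (Primes.congr ψ).injective]

/-- Finiteness of supports is preserved. [cite: MochizukiEtTh2009, Prop 5.3 proof p.326 (PDF p.100)] -/
theorem finite_supp_gpMap_iff (𝔖 : DivisorSupportDataQ 𝔓) (hI : 𝔖.PrincipalIffIntegralDegreeZero)
    (hP : ∀ x, ThetaFrobenioid.gpMap ψ.toMonoidHom x ∈ 𝔖.principal ↔ x ∈ 𝔖.principal)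
    (x : Algebra.GrothendieckGroup 𝔉.PhiAcirc) :
    (suppOf' 𝔖.factor (ThetaFrobenioid.gpMap ψ.toMonoidHom x)).Finite ↔ (suppOf' 𝔖.factor x).Finite := by
  rw [𝔖.supp_gpMap ψ hI hP]
  exact Set.finite_image_iff (Primes.congr ψ).injective.injOn

/-- Linear equivalence is transported (F1-`ψ`). [cite: MochizukiEtTh2009, Prop 5.3 proof p.326 (PDF p.100)] -/
theorem linEquiv_gpMap_iff (𝔖 : DivisorSupportDataQ 𝔓)
    (hP : ∀ x, ThetaFrobenioid.gpMap ψ.toMonoidHom x ∈ 𝔖.principal ↔ x ∈ 𝔖.principal)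
    (x y : Algebra.GrothendieckGroup 𝔉.PhiAcirc) :
    𝔖.LinEquiv (ThetaFrobenioid.gpMap ψ.toMonoidHom x) (ThetaFrobenioid.gpMap ψ.toMonoidHom y) ↔
      𝔖.LinEquiv x y := by
  change _ ∈ 𝔖.principal ↔ _ ∈ 𝔖.principal
  rw [← map_inv, ← map_mul, hP]

/-- Cuspidality of elements of `Φ(A_⊚)^gp` is transported, given Prop. 5.3 (i) on primes.
[cite: MochizukiEtTh2009, Prop 5.3 (i) p.325 (PDF p.99)] -/
theorem isCuspidalGp_gpMap_iff (𝔖 : DivisorSupportDataQ 𝔓) (hI : 𝔖.PrincipalIffIntegralDegreeZero)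
    (hc : ∀ 𝔭, 𝔓.IsCuspidal (Primes.congr ψ 𝔭) ↔ 𝔓.IsCuspidal 𝔭)
    (hP : ∀ x, ThetaFrobenioid.gpMap ψ.toMonoidHom x ∈ 𝔖.principal ↔ x ∈ 𝔖.principal)
    (x : Algebra.GrothendieckGroup 𝔉.PhiAcirc) :
    IsCuspidalGpOf' 𝔓 𝔖.factor (ThetaFrobenioid.gpMap ψ.toMonoidHom x) ↔ IsCuspidalGpOf' 𝔓 𝔖.factor x := by
  change (∀ 𝔭 ∈ suppOf' 𝔖.factor (ThetaFrobenioid.gpMap ψ.toMonoidHom x), 𝔓.IsCuspidal 𝔭) ↔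
    ∀ 𝔭 ∈ suppOf' 𝔖.factor x, 𝔓.IsCuspidal 𝔭
  rw [𝔖.supp_gpMap ψ hI hP, Set.forall_mem_image]
  exact forall₂_congr fun 𝔭 _ => hc 𝔭

/-- Coprimality is transported. [cite: MochizukiEtTh2009, Prop 5.3 proof p.326 (PDF p.100)] -/
theorem coprime_gpMap_iff (𝔖 : DivisorSupportDataQ 𝔓) (hI : 𝔖.PrincipalIffIntegralDegreeZero)
    (hP : ∀ x, ThetaFrobenioid.gpMap ψ.toMonoidHom x ∈ 𝔖.principal ↔ x ∈ 𝔖.principal)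
    (x y : Algebra.GrothendieckGroup 𝔉.PhiAcirc) :
    CoprimeOf' 𝔖.factor (ThetaFrobenioid.gpMap ψ.toMonoidHom x) (ThetaFrobenioid.gpMap ψ.toMonoidHom y) ↔
      CoprimeOf' 𝔖.factor x y := by
  change Disjoint (suppOf' 𝔖.factor _) (suppOf' 𝔖.factor _) ↔ Disjoint (suppOf' 𝔖.factor x) (suppOf' 𝔖.factor y)
  rw [𝔖.supp_gpMap ψ hI hP, 𝔖.supp_gpMap ψ hI hP]
  exact Set.disjoint_image_iff (Primes.congr ψ).injective

/-- **Cuspidal minimality is transported.** [cite: MochizukiEtTh2009, Prop 5.3 proof p.326 (PDF p.100)] -/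
theorem isCuspidallyMinimal_gpMap_iff (𝔖 : DivisorSupportDataQ 𝔓) (hI : 𝔖.PrincipalIffIntegralDegreeZero)
    (hc : ∀ 𝔭, 𝔓.IsCuspidal (Primes.congr ψ 𝔭) ↔ 𝔓.IsCuspidal 𝔭)
    (hP : ∀ x, ThetaFrobenioid.gpMap ψ.toMonoidHom x ∈ 𝔖.principal ↔ x ∈ 𝔖.principal)
    (x : Algebra.GrothendieckGroup 𝔉.PhiAcirc) :
    𝔖.IsCuspidallyMinimal (ThetaFrobenioid.gpMap ψ.toMonoidHom x) ↔ 𝔖.IsCuspidallyMinimal x := by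
  constructor
  · rintro ⟨h1, h2, h3⟩
    refine ⟨(𝔖.isCuspidalGp_gpMap_iff ψ hI hc hP x).mp h1, (𝔖.finite_supp_gpMap_iff ψ hI hP x).mp h2,
      fun y hy hyf hyx => ?_⟩
    have := h3 (ThetaFrobenioid.gpMap ψ.toMonoidHom y) ((𝔖.isCuspidalGp_gpMap_iff ψ hI hc hP y).mpr hy)
      ((𝔖.finite_supp_gpMap_iff ψ hI hP y).mpr hyf) ((𝔖.linEquiv_gpMap_iff ψ hP y x).mpr hyx)
    rwa [𝔖.ncard_supp_gpMap ψ hI hP, 𝔖.ncard_supp_gpMap ψ hI hP] at this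
  · rintro ⟨h1, h2, h3⟩
    refine ⟨(𝔖.isCuspidalGp_gpMap_iff ψ hI hc hP x).mpr h1, (𝔖.finite_supp_gpMap_iff ψ hI hP x).mpr h2,
      fun y hy hyf hyx => ?_⟩
    rw [← DivisorSupportData.gpMap_gpMap_symm ψ y] at hy hyf hyx ⊢
    have := h3 _ ((𝔖.isCuspidalGp_gpMap_iff ψ hI hc hP _).mp hy) ((𝔖.finite_supp_gpMap_iff ψ hI hP _).mp hyf)
      ((𝔖.linEquiv_gpMap_iff ψ hP _ x).mp hyx)
    rwa [𝔖.ncard_supp_gpMap ψ hI hP, 𝔖.ncard_supp_gpMap ψ hI hP]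

/-! ### `ψ` commutes with the pinned natural isomorphisms between primary components ((ii), (iii)) -/

/-- **[EtTh] Prop. 5.3 (ii) for `ψ`**: a monoid automorphism of `Φ(A_⊚)` preserving the principal elements commutes
with the natural isomorphisms between NON-cuspidal primary components (both are pinned by the prime log-divisors and
act as the identity on coordinates).  [cite: MochizukiEtTh2009, Prop 5.3 (ii) p.325 (PDF p.99); Rmk 3.8.2] -/
theorem map_ncspIso (𝔖 : DivisorSupportDataQ 𝔓) (hI : 𝔖.PrincipalIffIntegralDegreeZero)
    (hc : ∀ 𝔭, 𝔓.IsCuspidal (Primes.congr ψ 𝔭) ↔ 𝔓.IsCuspidal 𝔭)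
    (hP : ∀ x, ThetaFrobenioid.gpMap ψ.toMonoidHom x ∈ 𝔖.principal ↔ x ∈ 𝔖.principal)
    (𝔭 𝔮 : Primes 𝔉.PhiAcirc) (h𝔭 : ¬ 𝔓.IsCuspidal 𝔭) (h𝔮 : ¬ 𝔓.IsCuspidal 𝔮) (x : 𝔭.submonoid) :
    ψ (𝔓.ncspIso 𝔭 𝔮 h𝔭 h𝔮 x : 𝔉.PhiAcirc) =
      (𝔓.ncspIso _ _ (fun h => h𝔭 ((hc 𝔭).mp h)) (fun h => h𝔮 ((hc 𝔮).mp h))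
        (Primes.submonoidCongr ψ 𝔭 _ rfl x) : 𝔉.PhiAcirc) := by
  refine 𝔖.eq_of_ord_of_eq fun 𝔯 => ?_
  -- both sides lie on the line of `ψ𝔮`; compare coordinates there and off it
  have hL : ψ (𝔓.ncspIso 𝔭 𝔮 h𝔭 h𝔮 x : 𝔉.PhiAcirc) ∈ (Primes.congr ψ 𝔮).submonoid := by
    rw [Primes.mem_submonoid_congr_iff, ψ.symm_apply_apply]; exact (𝔓.ncspIso 𝔭 𝔮 h𝔭 h𝔮 x).2
  have hR := (𝔓.ncspIso _ _ (fun h => h𝔭 ((hc 𝔭).mp h)) (fun h => h𝔮 ((hc 𝔮).mp h))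
        (Primes.submonoidCongr ψ 𝔭 _ rfl x)).2
  rcases eq_or_ne 𝔯 (Primes.congr ψ 𝔮) with rfl | hne
  · -- at `ψ𝔮`: both coordinates equal `ord_𝔭 x`
    rw [𝔖.ord_ncspIso, Primes.coe_submonoidCongr_apply]
    have h1 := 𝔖.ordOf_map ψ hI hP 𝔮 (𝔓.ncspIso 𝔭 𝔮 h𝔭 h𝔮 x : 𝔉.PhiAcirc)
    have h2 := 𝔖.ordOf_map ψ hI hP 𝔭 (x : 𝔉.PhiAcirc)
    have e1 : 𝔖.ord (Primes.congr ψ 𝔮) (Algebra.GrothendieckGroup.of (ψ (𝔓.ncspIso 𝔭 𝔮 h𝔭 h𝔮 x : 𝔉.PhiAcirc))) =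
        𝔖.ord 𝔮 (Algebra.GrothendieckGroup.of (𝔓.ncspIso 𝔭 𝔮 h𝔭 h𝔮 x : 𝔉.PhiAcirc)) := by
      simp only [DivisorSupportDataQ.ord, ordGp_of, h1]
    have e2 : 𝔖.ord (Primes.congr ψ 𝔭) (Algebra.GrothendieckGroup.of (ψ (x : 𝔉.PhiAcirc))) =
        𝔖.ord 𝔭 (Algebra.GrothendieckGroup.of (x : 𝔉.PhiAcirc)) := by
      simp only [DivisorSupportDataQ.ord, ordGp_of, h2]
    rw [e1, e2, 𝔖.ord_ncspIso]
  · -- off `ψ𝔮`: both coordinates vanish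
    rw [(𝔖.mem_submonoid_iff_ord _ _).mp hL 𝔯 hne, (𝔖.mem_submonoid_iff_ord _ _).mp hR 𝔯 hne]

/-- **[EtTh] Prop. 5.3 (iii) for `ψ`**: the same for the natural isomorphisms between CUSPIDAL primary components.
[cite: MochizukiEtTh2009, Prop 5.3 (iii) p.325 (PDF p.99)] -/
theorem map_cspIso (𝔖 : DivisorSupportDataQ 𝔓) (hI : 𝔖.PrincipalIffIntegralDegreeZero)
    (hc : ∀ 𝔭, 𝔓.IsCuspidal (Primes.congr ψ 𝔭) ↔ 𝔓.IsCuspidal 𝔭)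
    (hP : ∀ x, ThetaFrobenioid.gpMap ψ.toMonoidHom x ∈ 𝔖.principal ↔ x ∈ 𝔖.principal)
    (𝔭 𝔮 : Primes 𝔉.PhiAcirc) (h𝔭 : 𝔓.IsCuspidal 𝔭) (h𝔮 : 𝔓.IsCuspidal 𝔮) (x : 𝔭.submonoid) :
    ψ (𝔓.cspIso 𝔭 𝔮 h𝔭 h𝔮 x : 𝔉.PhiAcirc) =
      (𝔓.cspIso _ _ ((hc 𝔭).mpr h𝔭) ((hc 𝔮).mpr h𝔮) (Primes.submonoidCongr ψ 𝔭 _ rfl x) : 𝔉.PhiAcirc) := by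
  refine 𝔖.eq_of_ord_of_eq fun 𝔯 => ?_
  have hL : ψ (𝔓.cspIso 𝔭 𝔮 h𝔭 h𝔮 x : 𝔉.PhiAcirc) ∈ (Primes.congr ψ 𝔮).submonoid := by
    rw [Primes.mem_submonoid_congr_iff, ψ.symm_apply_apply]; exact (𝔓.cspIso 𝔭 𝔮 h𝔭 h𝔮 x).2
  have hR := (𝔓.cspIso _ _ ((hc 𝔭).mpr h𝔭) ((hc 𝔮).mpr h𝔮) (Primes.submonoidCongr ψ 𝔭 _ rfl x)).2
  rcases eq_or_ne 𝔯 (Primes.congr ψ 𝔮) with rfl | hne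
  · rw [𝔖.ord_cspIso, Primes.coe_submonoidCongr_apply]
    have h1 := 𝔖.ordOf_map ψ hI hP 𝔮 (𝔓.cspIso 𝔭 𝔮 h𝔭 h𝔮 x : 𝔉.PhiAcirc)
    have h2 := 𝔖.ordOf_map ψ hI hP 𝔭 (x : 𝔉.PhiAcirc)
    have e1 : 𝔖.ord (Primes.congr ψ 𝔮) (Algebra.GrothendieckGroup.of (ψ (𝔓.cspIso 𝔭 𝔮 h𝔭 h𝔮 x : 𝔉.PhiAcirc))) =
        𝔖.ord 𝔮 (Algebra.GrothendieckGroup.of (𝔓.cspIso 𝔭 𝔮 h𝔭 h𝔮 x : 𝔉.PhiAcirc)) := by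
      simp only [DivisorSupportDataQ.ord, ordGp_of, h1]
    have e2 : 𝔖.ord (Primes.congr ψ 𝔭) (Algebra.GrothendieckGroup.of (ψ (x : 𝔉.PhiAcirc))) =
        𝔖.ord 𝔭 (Algebra.GrothendieckGroup.of (x : 𝔉.PhiAcirc)) := by
      simp only [DivisorSupportDataQ.ord, ordGp_of, h2]
    rw [e1, e2, 𝔖.ord_cspIso]
  · rw [(𝔖.mem_submonoid_iff_ord _ _).mp hL 𝔯 hne, (𝔖.mem_submonoid_iff_ord _ _).mp hR 𝔯 hne]

end DivisorSupportDataQ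

end FrobenioidThetaDivisors

end Literature.AnabelianGeometry.EtaleTheta
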